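import Summits.QuantumFields.BalabanUV.Beta.D1BFx.TorusGhostPairStencils

/-!
# «HALF-WORD ARRAYS» — the half-covariant tower words of route T as periodised `ℤ⁴` arrays (road «BF-x», slot (K); K-END-RECUT-SPEC v1 §2∕§4)

Owner ruling ρ-g7-5 ∕ FINDING F-g7-2 (journal l.25064, spec `HOME/b2b-balaban-beta-d1-p2/K-END-RECUT-SPEC.md` l.25308): under (R2) the exact ghost side of
route T is the HALF-covariant tower `AXD(U) := D_U*·D̂ + c·S` against the leg `Ggh`; its words along a fine bond `b = (σu, κ)` (tip `t = u + e_κ`) are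
**`Xh_b := −Ê_bᵀ·D̂`** (first order), **`+Ê_bᵀ·D̂`** (pure second order) and **`0`** (mixed, `b ≠ b′`) — `CovariantLaplacianJets` convention
`(D*)₁ = −Ėᵀ`, `(D*)₂ = +Ėᵀ`.  3b-gh FILE B1 (`TorusGhostWordArrays`) already has the building block `Ê_bᵀD̂ = perT (arr (etD κ u))`
(`transpose_Djet_mul_Dhat_eq_perT`); this file names the half-word families and records their sockets.

CONTENT (`σ := siteOf 4 s`, `t := u + e_κ`; all [folklore] finite-stencil algebra, the definitions assert nothing):
* §1 [our objects] `Xh κ u := −etD κ u` (stencil `(x,z) ↦ −[x = t]([z = t] − [z = u])`), `Xh₂ κ u l u′ := [u = u′ ∧ κ = l]·etD κ u`,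
  `XhSym κ u := ½•(ptPair t u + ptPair u t) − ptPair t t`; the DECOMPOSITION **`Xh = ½•ghCur + XhSym`** (half the ghost current + an ultra-local SYMMETRIC stencil;
  `XhSym_symm`; the current is antisymmetric, `GhostStencil.ghCur_antisymm`-shape) — the letter behind «HALF-WORD ROWS» ∕ «MAINTABLE-HALF»; localisation
  `BiLoc (Xh κ u) u u (e^{2δ}+e^{δ}) δ`, `BiLoc (Xh₂ κ u l u′) u u′ (e^{2δ}+e^{δ}) δ` (every real `δ`; ONE rate, the (P, P′, Q′, Q) letters of the TA3b sockets with
  `P = P′ = 0`, `Q′ = Q = z`), `BiLoc (XhSym κ u) …`; translation covariance of the three families.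
* §2 torus identities: **`−(Ê_bᵀ D̂) = perT (arr (Xh κ u))`** (every `s`; the pure second word `+Ê_bᵀ D̂ = perT (arr (etD κ u))` is B1's
  `transpose_Djet_mul_Dhat_eq_perT`, not restated), and for `|u − u′|₁ < s`
  **`[b = b′]·Ê_bᵀ D̂ = perT (arr (Xh₂ κ u l u′))`** (the torus test is the `ℤ⁴` test, `TorusGhostPairStencils.torus_test_iff`).
-/

noncomputable section

namespace Summit.QuantumFields.BalabanUV.Beta.D1BFx.TorusHalfWordArrays

open Matrix
open scoped BigOperators
open Literature.MathematicalPhysics.QuantumFieldTheory.Balaban1983to89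
open Literature.MathematicalPhysics.QuantumFieldTheory.Balaban1983to89.Beta
open B12Sec2to5 (l1 l1_nonneg)
open ExpKernelCalculus (MKer BiLoc shiftK)
open AffineAveraging (unitVec)
open KernelWard (biLoc_add biLoc_sub)
open SecondOrderResponse (biLoc_neg)
open Summit.QuantumFields.BalabanUV.Beta.D1BFx.PeriodicArrays (arr)
open Summit.QuantumFields.BalabanUV.Beta.D1BFx.GhostStencil (ghCur ghCur_apply ghCur_translate biLoc_ghCnt)
open Summit.QuantumFields.BalabanUV.Beta.D1BFx.TorusHodgeWeight (Dhat)
open Summit.QuantumFields.BalabanUV.Beta.D1BFx.TorusCoframeJets (Djet)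
open Summit.QuantumFields.BalabanUV.Beta.D1BFx.TorusJetArrays (ptPair ptPair_apply)
open Summit.QuantumFields.BalabanUV.Beta.D1BFx.TorusGhostWordArrays (perT etD etD_apply biLoc_hop biLoc_etD etD_translate transpose_Djet_mul_Dhat_eq_perT)
open Summit.QuantumFields.BalabanUV.Beta.D1BFx.TorusGhostPairStencils (perT_neg perT_zero arr_neg arr_zero biLoc_zero_of_nonneg torus_test_iff biLoc_hop' shiftK_ite)

variable (s : ℕ) [NeZero s]

/-! ## §1 The half-word stencils on `ℤ⁴` -/

section Stencils

variable (κ : Fin 4) (u : Fin 4 → ℤ) (l : Fin 4) (u' : Fin 4 → ℤ)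

/-- [our object] **THE FIRST-ORDER HALF WORD** `Xh κ u := −etD κ u`, i.e. the stencil `(x, z) ↦ −[x = u+e_κ]([z = u+e_κ] − [z = u])` — the `ℤ⁴` table of
`Xh_b = −Ê_bᵀ·D̂`. A definition; asserts nothing. -/
def Xh : MKer 4 Unit := -etD κ u

/-- [our object] **THE SECOND-ORDER HALF WORD** (pair family): `Xh₂ κ u l u′ := [u = u′ ∧ κ = l]·etD κ u` — pure second `+Ê_bᵀD̂`, mixed `0`. A definition. -/
def Xh₂ : MKer 4 Unit := if u = u' ∧ κ = l then etD κ u else 0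

/-- [our object] **THE ULTRA-LOCAL SYMMETRIC PART** `XhSym κ u := ½•(ptPair t u + ptPair u t) − ptPair t t`, `t = u + e_κ`. A definition; asserts nothing. -/
def XhSym : MKer 4 Unit :=
  (1 / 2 : ℝ) • (ptPair (u + unitVec κ) u + ptPair u (u + unitVec κ)) - ptPair (u + unitVec κ) (u + unitVec κ)

/-- [our object] Unfolding `Xh`. -/
theorem Xh_apply (x z : Fin 4 → ℤ) (a b : Unit) : Xh κ u x z a b
    = -((if x = u + unitVec κ ∧ z = u + unitVec κ then (1 : ℝ) else 0) - (if x = u + unitVec κ ∧ z = u then (1 : ℝ) else 0)) := rfl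

/-- [our object] Unfolding `XhSym`. -/
theorem XhSym_apply (x z : Fin 4 → ℤ) (a b : Unit) : XhSym κ u x z a b
    = (1 / 2 : ℝ) * ((if x = u + unitVec κ ∧ z = u then (1 : ℝ) else 0) + (if x = u ∧ z = u + unitVec κ then (1 : ℝ) else 0))
        - (if x = u + unitVec κ ∧ z = u + unitVec κ then (1 : ℝ) else 0) := rfl

/-- [folklore] **THE HALF WORD IS HALF THE CURRENT PLUS A SYMMETRIC STENCIL**: `Xh κ u = ½•ghCur κ u + XhSym κ u`. -/
theorem Xh_eq_half_ghCur_add_sym : Xh κ u = (1 / 2 : ℝ) • ghCur κ u + XhSym κ u := by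
  funext x z a b
  rw [Pi.add_apply, Pi.add_apply, Pi.add_apply, Pi.add_apply, Pi.smul_apply, Pi.smul_apply, Pi.smul_apply, Pi.smul_apply, smul_eq_mul,
    Xh_apply, XhSym_apply, ghCur_apply]
  ring

/-- [folklore] `XhSym` is symmetric. -/
theorem XhSym_symm (x z : Fin 4 → ℤ) (a b : Unit) : XhSym κ u z x b a = XhSym κ u x z a b := by
  rw [XhSym_apply, XhSym_apply,
    if_congr (and_comm : z = u + unitVec κ ∧ x = u ↔ x = u ∧ z = u + unitVec κ) rfl rfl,
    if_congr (and_comm : z = u ∧ x = u + unitVec κ ↔ x = u + unitVec κ ∧ z = u) rfl rfl,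
    if_congr (and_comm : z = u + unitVec κ ∧ x = u + unitVec κ ↔ x = u + unitVec κ ∧ z = u + unitVec κ) rfl rfl]
  ring

/-- [folklore] **LOCALISATION SOCKET** of `Xh`: `BiLoc (Xh κ u) u u (e^{2δ} + e^{δ}) δ` (every real `δ`). -/
theorem biLoc_Xh (δ : ℝ) : BiLoc (Xh κ u) u u (Real.exp (2 * δ) + Real.exp δ) δ := biLoc_neg (biLoc_etD κ u δ)

/-- [folklore] **LOCALISATION SOCKET** of `Xh₂`: `BiLoc (Xh₂ κ u l u′) u u′ (e^{2δ} + e^{δ}) δ` (every real `δ`; off the diagonal the family is `0`). -/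
theorem biLoc_Xh₂ (δ : ℝ) : BiLoc (Xh₂ κ u l u') u u' (Real.exp (2 * δ) + Real.exp δ) δ := by
  by_cases h : u = u' ∧ κ = l
  · rw [Xh₂, if_pos h, ← h.1]; exact biLoc_etD κ u δ
  · rw [Xh₂, if_neg h]; exact biLoc_zero_of_nonneg u u' (by positivity) δ

/-- [folklore] LOCALISATION of `XhSym`: `BiLoc (XhSym κ u) u u (|½|·(e^{δ} + e^{δ}) + e^{2δ}) δ`. -/
theorem biLoc_XhSym (δ : ℝ) : BiLoc (XhSym κ u) u u (|(1 / 2 : ℝ)| * (Real.exp δ + Real.exp δ) + Real.exp (2 * δ)) δ :=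
  biLoc_sub (StepJetData.biLoc_smul (biLoc_add (biLoc_hop κ u δ) (biLoc_hop' κ u δ)) _) (biLoc_ghCnt κ u δ)

/-- [folklore] **COVARIANCE** of `Xh`: `Xh κ (u + v) = shiftK (−v) (Xh κ u)`. -/
theorem Xh_translate (v : Fin 4 → ℤ) : Xh κ (u + v) = shiftK (-v) (Xh κ u) := by
  rw [Xh, Xh, etD_translate]; rfl

/-- [folklore] **JOINT COVARIANCE** of `Xh₂`: `Xh₂ κ (u + v) l (u′ + v) = shiftK (−v) (Xh₂ κ u l u′)`. -/
theorem Xh₂_translate (v : Fin 4 → ℤ) : Xh₂ κ (u + v) l (u' + v) = shiftK (-v) (Xh₂ κ u l u') := by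
  rw [Xh₂, Xh₂, shiftK_ite, ← etD_translate]
  simp only [add_left_inj]

/-- [folklore] **COVARIANCE** of `XhSym`. -/
theorem XhSym_translate (v : Fin 4 → ℤ) : XhSym κ (u + v) = shiftK (-v) (XhSym κ u) := by
  funext x z a b
  show XhSym κ (u + v) x z a b = XhSym κ u (x + -v) (z + -v) a b
  simp only [XhSym_apply, ← sub_eq_add_neg, sub_eq_iff_eq_add, add_right_comm u v (unitVec κ)]

end Stencils

/-! ## §2 The torus identities -/

section Torus

variable (κ : Fin 4) (u : Fin 4 → ℤ) (l : Fin 4) (u' : Fin 4 → ℤ)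

/-- [folklore] **THE FIRST-ORDER HALF WORD AS ONE ARRAY**: `−(Ê_bᵀ·D̂) = perT (arr (Xh κ u))` at `b = (σu, κ)`, every `s`. -/
theorem neg_transpose_Djet_mul_Dhat_eq_perT : -((Djet s (siteOf 4 s u, κ))ᵀ * Dhat 4 s) = perT s (arr s (Xh κ u)) := by
  rw [transpose_Djet_mul_Dhat_eq_perT, Xh, arr_neg, perT_neg]

/-- [folklore] **THE SECOND-ORDER HALF WORD AS ONE ARRAY** (pair form; `|u − u′|₁ < s`): `[b = b′]·Ê_bᵀ·D̂ = perT (arr (Xh₂ κ u l u′))` — pure second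
`+Ê_bᵀD̂` on the diagonal, `0` for `b ≠ b′`; the torus test `[(σu,κ) = (σu′,l)]` is the `ℤ⁴` test. -/
theorem halfWord₂_eq_perT (hs : l1 (u - u') < s) :
    (if (siteOf 4 s u, κ) = (siteOf 4 s u', l) then (Djet s (siteOf 4 s u, κ))ᵀ * Dhat 4 s else 0) = perT s (arr s (Xh₂ κ u l u')) := by
  by_cases h : u = u' ∧ κ = l
  · rw [if_pos ((torus_test_iff s κ l hs).mpr h), Xh₂, if_pos h, transpose_Djet_mul_Dhat_eq_perT]
  · rw [if_neg (fun hb => h ((torus_test_iff s κ l hs).mp hb)), Xh₂, if_neg h, arr_zero, perT_zero]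

end Torus

end Summit.QuantumFields.BalabanUV.Beta.D1BFx.TorusHalfWordArrays

end
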